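import Summits.BirchSwinnertonDyer.BirchSwinnertonDyer.Theorems.Rank2Observatory2DescClCurveCertE2Defs
import Summits.BirchSwinnertonDyer.BirchSwinnertonDyer.Theorems.Rank2Observatory2DescClFieldCertS
import HarnessLib

/-!
# BirchSwinnertonDyer — rank ≥ 2 observatory: KERNEL-2DESC-CL v3.0, S4 — the SPLIT-2 per-curve certificate (complex case), part 1/4: records and checkers

HONEST FRAMING: per-curve certified theorems and census instruments; no claim on BSD in rank ≥ 2.

Part 1 of 4 of the split-2 per-curve layer (design `…/v2/generics/v27/noeta/SPLIT2-SPEC.md`).  The mechanism,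
for the four parts: the 2-division field `K = ℚ(α)` has `2` TOTALLY SPLIT and every generator of even index, so
neither the one-view v2.0 contract (`ClCurveCert`, needs `ℤ[α] = 𝓞 K`) nor the two-view v2.3 contract
(`ClCurveCertE2`, needs a second monogenic order of coprime index) is satisfiable.  Here the field record is the
split record `ClFieldCertS` (`…ClFieldCertS`: the three primes `w₀, w₁, w₂` above `2` NAMED by elements of norm
`2·odd`, `…ClSplitPrimes`), and every element the certificate names — `e`, `D = F′(e)`, the `T`-unit family — is a
ONE-VIEW FRACTIONAL ELEMENT: `X = m₁·x ∈ ℤ[α]` (`m₁ = r₁²` a square killing `𝓞 K / ℤ[α]`) together with the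
characteristic polynomial `(T, S, N)` of `x` certifying integrality (`FracElt`, `…ClFracElt`).  Membership and
valuation at a prime above an ODD registry prime are read on `X` (`m₁` is prime to it); at the primes above `2`
they are read through the split certificate (`mem_w_of_linCheck` / `not_mem_w_of_linCheck` witnesses).  Since `m₁`
is a square, signs, `ord_{W₁}`, `ord_{W₂}` and the residue characters of `x` are those of `X`, so the v2.0 parity
rows are computed on `X` verbatim.  Support primes are TAGGED (`true` = an `α`-code, `false` = the split prime
`w_i`, `i = code.1 < 3`) and stored with their family element.  The abstract cover-set theorem
`mordellWeilRank_le_of_coverSet_cl` is applied to the genuine `𝓞 K` elements.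
This part: the records `ClFieldCertS2` (= `ClFieldCertS` + `r₁` + coprimality), `FamEntryS`, `ClCurveCertS`, and
the checkers `famCheckS`, `checkS r`.  New declarations only; nothing landed is touched.
Sorry-free; axioms `propext`, `Classical.choice`, `Quot.sound`.
[cite: Cassels1991LecturesEllipticCurves, §15] [cite: CremonaAlgorithms1997, §3.6] [cite: Cohen1993, §4.8.2, §6.5]
-/

set_option linter.dupNamespace false

noncomputable section

open scoped Classical NumberField nonZeroDivisors

open Literature.NumberTheory.NumberFields Polynomial Module NumberField IsDedekindDomain Ideal

namespace Summit.BirchSwinnertonDyer.BirchSwinnertonDyer.Rank2Observatory.TwoDescCl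

open TwoDescCubic ClFieldCert

/-! ## Records -/

/-- **Split-2 field constants**: the split field record plus `r₁` (`m₁ = r₁²` kills `𝓞 K / ℤ[α]`, a square).
Pure data. -/
structure ClFieldCertS2 where
  /-- the split field record -/
  fs : ClFieldCertS
  /-- `m₁ = r₁²` -/
  r₁ : ℕ

namespace ClFieldCertS2

/-- `m₁ = r₁²`. -/
def m₁ (F : ClFieldCertS2) : ℕ := F.r₁ ^ 2

/-- **Constants clause**: `0 < r₁`, `m₁` prime to `q` and to every `α`-row prime. Computable. -/
def checkConst (F : ClFieldCertS2) : Bool :=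
  decide (0 < F.r₁) && decide (Nat.Coprime F.m₁ F.fs.base.q) &&
    (F.fs.base.primes.all fun e => decide (Nat.Coprime F.m₁ e.p))

/-- **The complex split-2 field checker with constants**: complex field clause of `base`, the split core, the
constants. Computable; `decide +kernel` once per field. -/
def check2 (F : ClFieldCertS2) : Bool := F.fs.base.checkField && F.fs.checkCoreS && F.checkConst

variable (F : ClFieldCertS2)

/-- The complex field clause. -/
theorem field_of_check2 (h : F.check2 = true) : F.fs.base.checkField = true := by
  simp only [check2, Bool.and_eq_true] at h; exact h.1.1

/-- The split core. -/
theorem coreS_of_check2 (h : F.check2 = true) : F.fs.checkCoreS = true := by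
  simp only [check2, Bool.and_eq_true] at h; exact h.1.2

/-- The constants clause. -/
theorem const_of_check2 (F : ClFieldCertS2) (h : F.check2 = true) : F.checkConst = true := by
  simp only [check2, Bool.and_eq_true] at h; exact h.2

/-- `0 < r₁`. -/
theorem r₁_pos (F : ClFieldCertS2) (hK : F.checkConst = true) : 0 < F.r₁ := by
  simp only [checkConst, Bool.and_eq_true, decide_eq_true_eq] at hK; exact hK.1.1

/-- `0 < m₁`. -/
theorem m₁_pos (F : ClFieldCertS2) (hK : F.checkConst = true) : 0 < F.m₁ := pow_pos (F.r₁_pos hK) 2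

/-- `m₁` is prime to `q`. -/
theorem coprime_q (hK : F.checkConst = true) : Nat.Coprime F.m₁ F.fs.base.q := by
  simp only [checkConst, Bool.and_eq_true, decide_eq_true_eq] at hK; exact hK.1.2

/-- `m₁` is prime to every `α`-row prime. -/
theorem coprime_row (hK : F.checkConst = true) {e : PrimeEntry} (he : e ∈ F.fs.base.primes) :
    Nat.Coprime F.m₁ e.p := by
  simp only [checkConst, Bool.and_eq_true, decide_eq_true_eq, List.all_eq_true] at hK; exact hK.2 e he

end ClFieldCertS2

/-- **A split-2 family entry**: `kind` (`1` = the element `q`, anything else generic), `X = m₁x` in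
`α`-coordinates, the characteristic polynomial `(T, S, N)` of `x`, the sign bit, `e = ord_{W₁}(x)`, the `invCert`
datum at `w₂`, the factorisation `nf` of `|N(X)|`, the `α`-view exclusions, and the exclusions at the primes
above `2`: `(i, s, t)` certifies `x − 1 = 2s + π_i t`, i.e. `x ∉ w_i`. Pure data. -/
structure FamEntryS where
  /-- `1` = the element `q`; otherwise generic -/
  kind : ℕ
  /-- `m₁ · x` in `α`-coordinates -/
  X : ℤ × ℤ × ℤ
  /-- `(T, S, N)`: `x³ − T x² + S x − N = 0` -/
  tsn : ℤ × ℤ × ℤ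
  /-- sign bit at the real place (`true` = negative) -/
  sg : Bool
  /-- `ord_{W₁}(x)` -/
  e : ℕ
  /-- `invCert` datum: `X ∉ W₂` -/
  inv2 : ℤ × ℤ × ℤ
  /-- factorisation of `|N(X)|` -/
  nf : List (ℕ × ℕ)
  /-- `α`-view exclusions `(code, invCert datum)` -/
  invsA : List (PCode × (ℤ × ℤ × ℤ))
  /-- exclusions at the primes above `2`: `(i, s, t)` with `x − 1 = 2s + π_i t` -/
  miss2 : List (Fin 3 × FracElt × FracElt)

/-- The fractional element `x = X / m₁` of coordinates `X` and characteristic polynomial `tsn`. -/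
def fracOf (F : ClFieldCertS2) (X tsn : ℤ × ℤ × ℤ) : FracElt := ⟨X, F.m₁, tsn.1, tsn.2.1, tsn.2.2⟩

/-- **Split-2 per-curve certificate** for `y² = x³ + Ax² + Bx + C`: the 2-division root `e` and `D = F′(e)` as
fractional elements, the factorisation of `|N(X_D)|` with exclusions (`α`-view and at the primes above `2`),
membership witnesses of `D` at the split support primes, the `invCert` data at `W₁, W₂`, the sieve moduli, the
four head entries `−1, ε, γ, q`, and the support codes TAGGED (`true` = `α`-code, `false` = split prime
`w_i`, code `(i, 0, 0, 0)`) each WITH its family element. Pure data. [cite: Cassels1991LecturesEllipticCurves, §15] -/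
structure ClCurveCertS where
  /-- the model `(0, A, 0, B, C)` -/
  A : ℤ
  /-- the model -/
  B : ℤ
  /-- the model -/
  C : ℤ
  /-- irreducibility modulus for `X³ + AX² + BX + C` -/
  pF : ℕ
  /-- `m₁ · e` in `α`-coordinates -/
  Xt : ℤ × ℤ × ℤ
  /-- characteristic polynomial of `e` -/
  tsnT : ℤ × ℤ × ℤ
  /-- `m₁ · F′(e)` in `α`-coordinates -/
  XD : ℤ × ℤ × ℤ
  /-- characteristic polynomial of `F′(e)` -/
  tsnD : ℤ × ℤ × ℤ
  /-- factorisation of `|N(X_D)|` -/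
  dn : List (ℕ × ℕ)
  /-- `α`-view exclusions for `D` -/
  dinvA : List (PCode × (ℤ × ℤ × ℤ))
  /-- exclusions of `D` at primes above `2`: `(i, s, t)` with `D − 1 = 2s + π_i t` -/
  dmiss2 : List (Fin 3 × FracElt × FracElt)
  /-- memberships of `D` at the split support primes: `(i, s, t)` with `D = 2s + π_i t` -/
  dmem2 : List (Fin 3 × FracElt × FracElt)
  /-- `invCert` datum: `X_D ∉ W₁` -/
  dW1 : ℤ × ℤ × ℤ
  /-- `invCert` datum: `X_D ∉ W₂` -/
  dW2 : ℤ × ℤ × ℤ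
  /-- sieve moduli -/
  Q : List ℕ
  /-- the head of the family: `−1, ε, γ, q` (four entries) -/
  head : List FamEntryS
  /-- the support codes, tagged (`true` = `α`-code, `false` = split prime `code.1`), each with its element -/
  codes : List ((Bool × PCode) × FamEntryS)

/-! ## The checkers -/

section Checkers

variable (F : ClFieldCertS2) (cc : ClCurveCertS)

/-- The family: head entries then the code elements. -/
def famS : List FamEntryS := cc.head ++ cc.codes.map Prod.snd

/-- Exclusion witness at the primes above `2`: `x ∉ w_i`. Computable. -/
def missAt (x : FracElt) (miss2 : List (Fin 3 × FracElt × FracElt)) (i : Fin 3) : Bool :=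
  miss2.any fun ws => decide (ws.1 = i) && (ws.2.1.check F.fs.base.a F.fs.base.b F.fs.base.c &&
    (ws.2.2.check F.fs.base.a F.fs.base.b F.fs.base.c &&
      FracElt.linCheck F.fs.base.a F.fs.base.b F.fs.base.c 2 1 x (F.fs.split.pi i) ws.2.1 ws.2.2))

/-- **Prime dispatch**: the rational prime `p` of a norm factorisation is `q`, or has an `α`-row each of whose
codes is a support code or misses the element (`invCert` on `X`), or is `2` and each prime above `2` is a support
code or misses the element (split witness). Computable. -/
def primeDispatchS (x : FracElt) (X : ℤ × ℤ × ℤ) (invsA : List (PCode × (ℤ × ℤ × ℤ)))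
    (miss2 : List (Fin 3 × FracElt × FracElt)) (p : ℕ) : Bool :=
  (p == F.fs.base.q) ||
    ((F.fs.base.primes.any fun e => e.p == p) &&
      ((F.fs.base.row p).codes.all fun C' => decide ((true, C') ∈ cc.codes.map Prod.fst) ||
        invsA.any fun ci => ci.1 == C' && invCert F.fs.base.a F.fs.base.b F.fs.base.c C' X ci.2)) ||
    ((p == 2) && decide (∀ i : Fin 3,
      (false, ((i : ℕ), (0 : ℤ), (0 : ℤ), (0 : ℤ))) ∈ cc.codes.map Prod.fst ∨ missAt F x miss2 i = true))

/-- **Support-code clause**: an `α`-code is present in the registry and its prime contains `D` (`memCode`); a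
split code `i < 3` carries a membership witness `D = 2s + π_i t`. Computable. -/
def codeClauseS (bc : (Bool × PCode) × FamEntryS) : Bool :=
  if bc.1.1 then
    (F.fs.base.primes.any fun e => e.p == bc.1.2.1) && decide (bc.1.2 ∈ (F.fs.base.row bc.1.2.1).codes) &&
      memCode bc.1.2 cc.XD
  else
    decide (bc.1.2 = (bc.1.2.1, 0, 0, 0)) &&
      cc.dmem2.any fun ws => decide ((ws.1 : ℕ) = bc.1.2.1) && (ws.2.1.check F.fs.base.a F.fs.base.b F.fs.base.c &&
        (ws.2.2.check F.fs.base.a F.fs.base.b F.fs.base.c &&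
          FracElt.linCheck F.fs.base.a F.fs.base.b F.fs.base.c 2 0 (fracOf F cc.XD cc.tsnD)
            (F.fs.split.pi ws.1) ws.2.1 ws.2.2))

/-- Kind-specific clause: the element `q` is literally `X = (m₁ q, 0, 0)`; a generic element misses `W₂` and has
certified `ord_{W₁}` (read on `X`, `q ∤ m₁`). Computable. -/
def famKindCheckS (f : FamEntryS) : Bool :=
  if f.kind = 1 then decide (f.X = ((F.m₁ : ℤ) * F.fs.base.q, 0, 0))
  else invCert F.fs.base.a F.fs.base.b F.fs.base.c F.fs.base.w₂ f.X f.inv2 &&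
    ordCheck F.fs.base.q (normFormZ F.fs.base.a F.fs.base.b F.fs.base.c f.X.1 f.X.2.1 f.X.2.2).natAbs f.e

/-- **The split-2 family-entry check.** Computable. [cite: Cassels1991LecturesEllipticCurves, §15] -/
def famCheckS (f : FamEntryS) : Bool :=
  (fracOf F f.X f.tsn).check F.fs.base.a F.fs.base.b F.fs.base.c &&
    signCond F.fs.base.lo F.fs.base.hi f.X f.sg &&
    decide (normFormZ F.fs.base.a F.fs.base.b F.fs.base.c f.X.1 f.X.2.1 f.X.2.2 ≠ 0) &&
    decide (((F.m₁ : ℤ)) ^ 3 ∣ normFormZ F.fs.base.a F.fs.base.b F.fs.base.c f.X.1 f.X.2.1 f.X.2.2) &&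
    (F.fs.base.chars.all fun ch => !decide ((ch.1 : ℤ) ∣ evalInt ch.2.1 f.X)) &&
    decide ((normFormZ F.fs.base.a F.fs.base.b F.fs.base.c f.X.1 f.X.2.1 f.X.2.2).natAbs =
      (f.nf.map fun pe => pe.1 ^ pe.2).prod) &&
    (f.nf.all fun pe => primeDispatchS F cc (fracOf F f.X f.tsn) f.X f.invsA f.miss2 pe.1) &&
    famKindCheckS F f

/-- `log ord_{W₁}`: `−1` for `q`, `−e` otherwise. -/
def famL₁S (f : FamEntryS) : ℤ := if f.kind = 1 then -1 else -(f.e : ℤ)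

/-- `log ord_{W₂}`: `−1` for `q`, `0` otherwise. -/
def famL₂S (f : FamEntryS) : ℤ := if f.kind = 1 then -1 else 0

/-- Row `k` of the parity matrix at an entry (computed on `X`). -/
def bitRowS (fc : ClFieldCert) (f : FamEntryS) : ℕ → Bool
  | 0 => f.sg
  | 1 => !decide ((2 : ℤ) ∣ famL₁S f)
  | 2 => !decide ((2 : ℤ) ∣ famL₂S f)
  | k + 3 => eulerBit (fc.chars.getD k (3, 0, 0)).1 (evalInt (fc.chars.getD k (3, 0, 0)).2.1 f.X)

/-- The parity matrix. -/
def bitS (k : Fin (F.fs.base.chars.length + 3)) (j : Fin (famS cc).length) : Bool :=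
  bitRowS F.fs.base ((famS cc).get j) k

/-- The norms of the family (`N(x) = N(X) / m₁³`). -/
def famNormS (j : Fin (famS cc).length) : ℤ :=
  normFormZ F.fs.base.a F.fs.base.b F.fs.base.c ((famS cc).get j).X.1 ((famS cc).get j).X.2.1
    ((famS cc).get j).X.2.2 / (F.m₁ : ℤ) ^ 3

/-- The sign bits of the family. -/
def famSignS (j : Fin (famS cc).length) : Bool := ((famS cc).get j).sg

/-- The sieve. -/
def admS (T : Finset (Fin 0)) (U : Finset (Fin (famS cc).length)) : Bool :=
  admStdQ cc.Q (fun i : Fin 0 => i.elim0) (famNormS F cc) (fun i : Fin 0 => i.elim0) (famSignS cc) T U &&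
    decide (Even (U.filter fun j => bitRowS F.fs.base ((famS cc).get j) 1 = true).card) &&
    decide (Even (U.filter fun j => bitRowS F.fs.base ((famS cc).get j) 2 = true).card)

/-- **The split-2 per-curve `r`-checker.** Computable; run by `decide +kernel`.
[cite: Cassels1991LecturesEllipticCurves, §15] -/
def checkS (r : ℕ) : Bool :=
  decide (deltaShort cc.A cc.B cc.C ≠ 0) &&
    noRootMod cc.pF cc.A cc.B cc.C &&
    decide (cubicAtCoords F.fs.base.a F.fs.base.b F.fs.base.c ((F.m₁ : ℤ) * cc.A) ((F.m₁ : ℤ) ^ 2 * cc.B)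
      ((F.m₁ : ℤ) ^ 3 * cc.C) cc.Xt = (0, 0, 0)) &&
    decide (derivAtCoords F.fs.base.a F.fs.base.b F.fs.base.c ((F.m₁ : ℤ) * cc.A) ((F.m₁ : ℤ) ^ 2 * cc.B) cc.Xt =
      MonicCubic.mulCoords F.fs.base.a F.fs.base.b F.fs.base.c (smulCoords (F.m₁ : ℤ) cc.XD)
        (prodPowCoords F.fs.base.a F.fs.base.b F.fs.base.c [])) &&
    (fracOf F cc.Xt cc.tsnT).check F.fs.base.a F.fs.base.b F.fs.base.c &&
    (fracOf F cc.XD cc.tsnD).check F.fs.base.a F.fs.base.b F.fs.base.c &&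
    decide (MonicCubic.disc cc.A cc.B cc.C < 0) &&
    decide (normFormZ F.fs.base.a F.fs.base.b F.fs.base.c cc.XD.1 cc.XD.2.1 cc.XD.2.2 ≠ 0) &&
    decide ((normFormZ F.fs.base.a F.fs.base.b F.fs.base.c cc.XD.1 cc.XD.2.1 cc.XD.2.2).natAbs =
      (cc.dn.map fun pe => pe.1 ^ pe.2).prod) &&
    (cc.dn.all fun pe => primeDispatchS F cc (fracOf F cc.XD cc.tsnD) cc.XD cc.dinvA cc.dmiss2 pe.1) &&
    (cc.codes.all fun bc => codeClauseS F cc bc) &&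
    invCert F.fs.base.a F.fs.base.b F.fs.base.c F.fs.base.w₁ cc.XD cc.dW1 &&
    invCert F.fs.base.a F.fs.base.b F.fs.base.c F.fs.base.w₂ cc.XD cc.dW2 &&
    (cc.Q.all fun q => decide (0 < q)) &&
    decide (cc.head.length = 4) &&
    ((famS cc).all fun f => famCheckS F cc f) &&
    decide (∀ T : Finset (Fin (famS cc).length), T ≠ ∅ →
      ∃ k : Fin (F.fs.base.chars.length + 3), Odd (T.filter fun j => bitS F cc k j = true).card) &&
    decide (((Finset.univ ×ˢ Finset.univ).filter
      (fun p : Finset (Fin 0) × Finset (Fin (famS cc).length) => admS F cc p.1 p.2 = true)).card ≤ 2 ^ r)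

end Checkers

end Summit.BirchSwinnertonDyer.BirchSwinnertonDyer.Rank2Observatory.TwoDescCl

end
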